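import Summits.BirchSwinnertonDyer.BirchSwinnertonDyer.Theorems.AlignedTransportAtTwoMainConjectureOfRankZeroBSDAtTwoCubicCarrierRoad
import Summits.BirchSwinnertonDyer.BirchSwinnertonDyer.Theorems.ByReductionTypeAtTwoAdditivePotMultConjATwoAdmissibleCarriers
import HarnessLib

/-!
# Route `AlignedTransportAtTwo`, crux C2 `MainConjectureOfRankZeroBSDAtTwo` (stmt-BirchSwinnertonDyer-22298):
# CARRIER WIDENING on the `0 < Δ_W` third — `MC₂(W)` from `μ₂ = 0` of ANY admissible totally complex sextic
# `ℚ(x(T), x)`, `x² ∈ {−1, −2, −Δ_W, −2Δ_W}` (relaxed-at-`∞` currency, KERNEL), and the crux BY NAME from PRINT⁵ + MuIneqʳ + H3M⁻ + H6∃⁺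

HONEST FRAMING (cell `bsd-f1-sign2`, WIDTH-5 attached prover seat `bsd-line-att-p5` gen 24 on line `birth` of the lead
`bsd-line-att-p2`; `--supports` stmt-BirchSwinnertonDyer-22298, closes nothing; BSD is NOT proved by any of this; the crux C2,
its verdict «blocked-on `Rank1Residual.GreenbergMuConjectureIrreducible`» and every registered stub are untouched). THEOREMS ONLY —
no definition, no named fact, no `sorry`; every arithmetic input is a DISPLAYED hypothesis. Sequel of `…CubicCarrierRoad` (p739408) and
`…CubicCriterion` (p740601) of this seat.

WHY. On the `0 < Δ_W` third of the seed cell (`ℚ(x(T))` totally real) the cubic road needs NARROW data (H3M⁺ = `μ₂(ℚ(β)) = 0` ∧ a bounded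
unit-signature defect along the tower, REF1 §239 R239a), and att-p5 g23's PFμ⁶ uses the single carrier `ℚ(P, √−1)`. Cell bsd-2adic's
seat `k4-w3` GEN 10 (`…AdditivePotMultConjATwoAdmissibleCarriers`) widened the carrier for its STRICT statement-(A) cone: the descent behind
the `√−1` door uses of `i` only that (1) `i` is fixed by every `g ∈ Γ_ℚ` fixing `W[2]` pointwise with `χ₂(g) = 1` and (2) the carrier is
totally complex — so ANY admissible `x` works, and `√−2 = ζ₈ + ζ₈³`, `√−Δ = 4iδ`, `√−2Δ` are admissible (their §2, kernel). Their generic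
door returns the STRICT `∃ γ D` form, but its proof passes through the RELAXED-at-`∞` finiteness, which is C2's currency on `0 < Δ_W`
(where relaxed ≠ strict). This file re-runs that proof to its relaxed station and composes with the (b″) engine:

* §1 (any number field `K`) **`finite_twoTorsion_fineRelaxed_of_classicalMu_pointField_adjoin_of_fixed`** — `P ∈ E[2] ∖ 0`, `x ∈ K̄`
  admissible ((1) above) with `F = K̄^{Stab P} ⊔ K⟮x⟯` totally complex: `μ₂ = 0` for the cyclotomic `ℤ₂`-extensions of `F` ⟹
  `Sel₀^{rel ∞}(K_∞, E[2^∞])[2]` finite (k4-w3's proof VERBATIM, stopped before «relaxed ⟹ strict»).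
* §2 (`ℚ`, `β = x(T)`-currency) **`lengthAt_relaxedDual_eq_zero_of_classicalMu_cubicField_adjoin_of_fixed`** (`x² = q < 0` rational,
  admissible) and **`mazurMainConjecture_two_of_muIneqRel_of_classicalMu_cubicField_adjoin_of_fixed`**: PRINT⁵ + MuIneqʳ + cell hyps +
  `μ₂(ℚ(β) ⊔ ℚ(x)) = 0` ⟹ `MC₂(W)`; **`mazurMainConjecture_two_of_muIneqRel_of_exists_admissibleCarrierMu`** (`0 < Δ_W`): the same from
  «SOME `x` with `x² ∈ {−1, −2, −Δ_W, −2Δ_W}` has `μ₂(ℚ(β, x)^{cyc}) = 0`» — FOUR totally complex sextic carriers per curve, plain `μ₂`,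
  no narrow data.
* §3 (the cell, BY NAME) **`mainConjectureOfRankZeroBSDAtTwo_of_muIneqRel_of_cubicFieldMu_of_exists_admissibleCarrierMu`**:
  the crux ⟸ PRINT⁵ + MuIneqʳ + H3M⁻ (complex cubic `ℚ(x(T))` on `Δ_W < 0`, p739408) + H6∃⁺ («for every seed `W` with `0 < Δ_W` and every
  root `β`: some admissible `x` with `μ₂(ℚ(β, x)^{cyc}) = 0`»).

INPUT LEDGER of C2 after this file: PRINT⁵ + MuIneqʳ + H3M⁻ + [H3M⁺ ∨ H6∃⁺ per seed on the totally real third]. All `μ₂`-inputs are OPEN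
Iwasawa statements about explicit non-abelian cubic / sextic fields; nothing is asserted about them; nothing is closed; BSD is not proved.

References: [Lim2017FineSelmer] §3 Thm. 3.5, Lemma 3.2; [CoatesSujatha2005] §3 (A), Thm. 3.4; [Iwasawa1973MuInvariants] §1; [SilvermanAEC2009]
III.§1, VIII.§1; [Serre1968] Ch. I §1.2; [Washington1997] §13.1; [Kato2004Asterisque] Thm. 17.4, §17.13; [GreenbergLNM1716] Conj. 1.11,
Thm. 4.1, Lemma 4.6; tree p718233 (w2 GEN 6), k4-w3 GEN 10 (`…AdmissibleCarriers`), p736077, p739408, p740601.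
-/

set_option linter.dupNamespace false
set_option autoImplicit false

noncomputable section

open scoped Classical NumberField Polynomial IntermediateField

namespace Summit.BirchSwinnertonDyer.BirchSwinnertonDyer.Theorems.AlignedTransportAtTwoAdmissibleCarriers

open WeierstrassCurve NumberField IsDedekindDomain Field Polynomial IntermediateField
open Literature.NumberTheory.EllipticCurves Literature.NumberTheory.EllipticCurves.GreenbergSelmer
  Literature.NumberTheory.EllipticCurves.ZpExtension Literature.NumberTheory.GaloisRepresentations Literature.NumberTheory.IwasawaTheory
  Literature.NumberTheory.EllipticCurves.Rank1Residual
  Literature.NumberTheory.EllipticCurves.DokchitserDokchitser2012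
open Summit.BirchSwinnertonDyer.BirchSwinnertonDyer.Theorems.AlignedTransportAtTwoFineRoad
open Summit.BirchSwinnertonDyer.BirchSwinnertonDyer.Theorems.AlignedTransportAtTwoTorsionPointField
open Summit.BirchSwinnertonDyer.BirchSwinnertonDyer.Theorems.SteinbergFibreAtTwo

/-! ## §1 The generic RELAXED door: any admissible `x`, every number field `K` -/

section Generic

variable {K : Type} [Field K] [NumberField K] (W : WeierstrassCurve K) [W.IsElliptic]

/-- **`Sel₀^{rel ∞}(K_∞, E[2^∞])[2]` finite from `μ₂ = 0` on the carrier `F = K̄^{Stab P} ⊔ K⟮x⟯` for ANY admissible `x`** (`E = W/K`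
elliptic over a number field, `P ∈ E[2] ∖ 0`, `x ∈ K̄` (1) fixed by every `g ∈ Γ_K` fixing `E[2]` pointwise with `χ₂(g) = 1` and (2) such
that `F` is totally complex). The RELAXED-at-`∞` station of k4-w3 GEN 10's `AddKatoTwo.exists_fineSelmerDualData_moduleFinite_of_classicalMu_pointField_adjoin_of_fixed`
(proof verbatim up to its last step: unipotent flag `ℤ·(σ₀ • P)`, upstairs prime-wise finiteness over `galImage(ker κ_F)`, Lim's Lemma 3.2
descent with `N = ker ρ̄_{E,2} ⊓ ker χ₂`). [cite: Lim2017FineSelmer, §3 Thm. 3.5 and Lemma 3.2] [cite: CoatesSujatha2005, statement (A), Thm. 3.4]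
[cite: Iwasawa1973MuInvariants, §1 (input only)] -/
theorem finite_twoTorsion_fineRelaxed_of_classicalMu_pointField_adjoin_of_fixed {P : geomTorsion W 2} (hP : P ≠ 0)
    {x : AlgebraicClosure K}
    (hx : ∀ g : absoluteGaloisGroup K, (∀ T : geomTorsion W ((2 : ℕ) : ℤ), g • T = T) →
      GaloisRep.cyclotomicCharacter K 2 g = 1 → g • x = x)
    (hxc : ∀ w : InfinitePlace ↥(IntermediateField.fixedField (MulAction.stabilizer (absoluteGaloisGroup K) P) ⊔
      IntermediateField.adjoin K ({x} : Set (AlgebraicClosure K))), w.IsComplex)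
    (hμ : ∀ κF : ZpExtension ↥(IntermediateField.fixedField (MulAction.stabilizer (absoluteGaloisGroup K) P) ⊔
        IntermediateField.adjoin K ({x} : Set (AlgebraicClosure K))) 2, κF.IsCyclotomic → ClassicalMuVanishes κF)
    (κ : ZpExtension K 2) (hκ : κ.IsCyclotomic) :
    Set.Finite {s : W.fineSelmerInftyRelaxedInf κ | 2 • s = 0} := by
  haveI : Fact (Nat.Prime 2) := ⟨Nat.prime_two⟩
  haveI : NeZero ((2 : ℕ) : K) := ⟨by exact_mod_cast (two_ne_zero : (2 : K) ≠ 0)⟩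
  -- the carrier `F`: a totally complex number field
  have hint : IsIntegral K x := (Algebra.IsAlgebraic.isAlgebraic (R := K) x).isIntegral
  haveI := IntermediateField.adjoin.finiteDimensional hint
  haveI := finiteDimensional_fixedField_stabilizer W P
  haveI : NumberField ↥(IntermediateField.fixedField (MulAction.stabilizer (absoluteGaloisGroup K) P) ⊔
      IntermediateField.adjoin K ({x} : Set (AlgebraicClosure K))) := NumberField.of_module_finite K _
  have hFc := hxc
  -- a cyclotomic `ℤ₂`-extension of `F`
  obtain ⟨κF, hκF⟩ := ZpExtension.exists_isCyclotomic_holds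
    (↥(IntermediateField.fixedField (MulAction.stabilizer (absoluteGaloisGroup K) P) ⊔
      IntermediateField.adjoin K ({x} : Set (AlgebraicClosure K)))) 2 (GaloisRep.cyclotomicCharacter_range_infinite _ 2)
  -- the unipotent flag `ℤ·(σ₀ • P)`
  obtain ⟨σ₀, hσ₀⟩ := PointFieldMu.exists_smul_twoTorsion_fixed_by_resGal W P x
  have hP' : σ₀ • P ≠ 0 := fun h ↦ hP (by rw [← inv_smul_smul σ₀ P, h, smul_zero])
  set C : AddSubgroup (geomTorsion W ((2 : ℕ) : ℤ)) := AddSubgroup.zmultiples (σ₀ • P) with hC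
  have hC1 : ∀ (τ : absoluteGaloisGroup ↥(IntermediateField.fixedField (MulAction.stabilizer (absoluteGaloisGroup K) P) ⊔
      IntermediateField.adjoin K ({x} : Set (AlgebraicClosure K)))) (Q : geomTorsion W ((2 : ℕ) : ℤ)),
      Q ∈ C → resGal (K := K) _ τ • Q = Q := by
    intro τ Q hQ
    obtain ⟨k, rfl⟩ := AddSubgroup.mem_zmultiples_iff.mp hQ
    rw [show resGal (K := K) _ τ • (k • (σ₀ • P)) = k • (resGal (K := K) _ τ • (σ₀ • P)) from
      map_zsmul (DistribSMul.toAddMonoidHom (geomTorsion W ((2 : ℕ) : ℤ)) (resGal (K := K) _ τ)) k (σ₀ • P), hσ₀ τ]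
  have hC2 : ∀ (τ : absoluteGaloisGroup ↥(IntermediateField.fixedField (MulAction.stabilizer (absoluteGaloisGroup K) P) ⊔
      IntermediateField.adjoin K ({x} : Set (AlgebraicClosure K)))) (Q : geomTorsion W ((2 : ℕ) : ℤ)),
      resGal (K := K) _ τ • Q - Q ∈ C :=
    fun τ Q ↦ smul_sub_mem_zmultiples_of_smul_eq hP' (hσ₀ τ) Q
  -- upstairs, prime-wise, over `Ω = galImage(ker κ_F)`
  have hup := FineSelmerUpstairs.finite_primewiseFine_pTorsion_galImage_of_unipotent W hFc C hC1 hC2 κF hκF (hμ κF hκF)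
  -- `N = ker ρ̄_{E,2} ⊓ ker χ₂ ≤ Ω ≤ ker κ`
  have hkerF := FineSelmerFiniteOfUnramifiedClasses.kerSubgroup_eq_comap_of_isCyclotomic κ hκ κF hκF
  have hΩ : BaseChangeModel.galImage K _ κF.kerSubgroup ≤ κ.kerSubgroup := by
    unfold BaseChangeModel.galImage
    rw [resGal_eq_absGaloisRestrict, hkerF]
    exact Subgroup.map_comap_le _ _
  obtain ⟨e, he⟩ := exists_mem_range_absGaloisRestrict_iff K
    ↥(IntermediateField.fixedField (MulAction.stabilizer (absoluteGaloisGroup K) P) ⊔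
      IntermediateField.adjoin K ({x} : Set (AlgebraicClosure K)))
  have hNΩ : (W.galoisRepTorsion 2).ker ⊓ (GaloisRep.cyclotomicCharacter K 2).toMonoidHom.ker ≤
      BaseChangeModel.galImage K _ κF.kerSubgroup := by
    intro g hg
    obtain ⟨hρ, hχ⟩ := Subgroup.mem_inf.1 hg
    rw [MonoidHom.mem_ker] at hρ hχ
    change GaloisRep.cyclotomicCharacter K 2 g = 1 at hχ
    have hρ' : ∀ T : geomTorsion W ((2 : ℕ) : ℤ), g • T = T := fun T ↦ by
      rw [← galoisRepTorsion_apply]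
      have e2 : W.galoisRepTorsion ((2 : ℕ) : ℤ) g = 1 := hρ
      rw [e2]
      rfl
    -- `g` (and every Γ_K-conjugate of it) fixes `F` pointwise
    have hfixF : ∀ (ρ : absoluteGaloisGroup K) (y : AlgebraicClosure K),
        y ∈ IntermediateField.fixedField (MulAction.stabilizer (absoluteGaloisGroup K) P) ⊔
          IntermediateField.adjoin K ({x} : Set (AlgebraicClosure K)) → (ρ⁻¹ * g * ρ) • y = y := by
      intro ρ y hy
      have hmem : absoluteGaloisGroup.toAlgEquiv K (ρ⁻¹ * g * ρ) ∈
          (IntermediateField.fixedField (MulAction.stabilizer (absoluteGaloisGroup K) P) ⊔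
            IntermediateField.adjoin K ({x} : Set (AlgebraicClosure K))).fixingSubgroup := by
        rw [IntermediateField.fixingSubgroup_sup]
        refine ⟨?_, ?_⟩
        · have hst : ρ⁻¹ * g * ρ ∈ MulAction.stabilizer (absoluteGaloisGroup K) P := by
            rw [MulAction.mem_stabilizer_iff, mul_smul, mul_smul, hρ' (ρ • P), inv_smul_smul]
          exact (IntermediateField.le_iff_le _ _).1 le_rfl hst
        · refine (FineSelmerUpstairs.mem_fixingSubgroup_adjoin_simple_iff x _).2 ?_
          rw [← absoluteGaloisGroup.smul_def]
          refine hx (ρ⁻¹ * g * ρ) (fun T ↦ by rw [mul_smul, mul_smul, hρ' (ρ • T), inv_smul_smul]) ?_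
          rw [map_mul, map_mul, hχ, mul_one, ← map_mul, inv_mul_cancel, map_one]
      rw [absoluteGaloisGroup.smul_def]
      exact (IntermediateField.mem_fixingSubgroup_iff _ _).1 hmem y hy
    -- hence `g` fixes `e(F)`
    have hrange : g ∈ (absGaloisRestrict K ↥(IntermediateField.fixedField (MulAction.stabilizer (absoluteGaloisGroup K) P) ⊔
        IntermediateField.adjoin K ({x} : Set (AlgebraicClosure K)))).range := by
      refine (he g).2 fun y ↦ ?_
      let eL : AlgebraicClosure K →ₐ[K] AlgebraicClosure K := e.liftNormal (AlgebraicClosure K)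
      have heL : eL (y : AlgebraicClosure K) = e y := by
        have h := e.liftNormal_commutes (AlgebraicClosure K) y
        simpa using h
      let σ' : AlgebraicClosure K ≃ₐ[K] AlgebraicClosure K :=
        AlgEquiv.ofBijective eL (Algebra.IsAlgebraic.algHom_bijective eL)
      set σ : absoluteGaloisGroup K := (absoluteGaloisGroup.toAlgEquiv K).symm σ' with hσdef
      have hσ : absoluteGaloisGroup.toAlgEquiv K σ = σ' := (absoluteGaloisGroup.toAlgEquiv K).apply_symm_apply σ'
      have hey : (e y : AlgebraicClosure K) = σ • (y : AlgebraicClosure K) := by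
        rw [absoluteGaloisGroup.smul_def, hσ]
        exact heL.symm
      rw [hey, show g • σ • (y : AlgebraicClosure K) = σ • ((σ⁻¹ * g * σ) • (y : AlgebraicClosure K)) by
        rw [mul_smul, mul_smul, smul_inv_smul], hfixF σ y y.2]
    unfold BaseChangeModel.galImage
    rw [resGal_eq_absGaloisRestrict, hkerF]
    change g ∈ Subgroup.map (absGaloisRestrict K _).toMonoidHom
      (Subgroup.comap (absGaloisRestrict K _).toMonoidHom κ.kerSubgroup)
    rw [Subgroup.map_comap_eq]
    refine Subgroup.mem_inf.2 ⟨hrange, ?_⟩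
    rw [show κ.kerSubgroup = _ from hκ, Subgroup.mem_comap]
    change GaloisRep.cyclotomicCharacter K 2 g ∈ CommGroup.torsion ℤ_[2]ˣ
    rw [hχ]
    exact (CommGroup.torsion ℤ_[2]ˣ).one_mem
  -- descend to the RELAXED-at-`∞` fine Selmer group over `K_∞`
  exact PointFieldMu.finite_pTorsion_fineRelaxed_of_primewise_upstairs W 2 κ hNΩ hΩ
    (PointFieldMu.finiteIndex_upstairs_subgroupOf' W κ hκ) hup

end Generic

/-! ## §2 Over `ℚ`, `β = x(T)`-currency: `ℓ₍₂₎(X₀^{rel∞}) = 0` and `MC₂(W)` from any admissible carrier `ℚ(β, x)`, `x² = q < 0` -/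

section RatTwo

open CongruenceSubgroup Literature.NumberTheory.EllipticCurves.ModularForms Literature.NumberTheory.EllipticCurves.Greenberg1999
  Literature.NumberTheory.EllipticCurves.Module
  Summit.BirchSwinnertonDyer.Rank1Residual Summit.BirchSwinnertonDyer.Rank1Residual.X1.MuLambda
  Summit.BirchSwinnertonDyer.Rank1Residual.X5 Summit.BirchSwinnertonDyer.Rank1Residual.F1Sign2
  Summit.BirchSwinnertonDyer.BirchSwinnertonDyer.Theorems.Rank1ResidualX1Defs
  Summit.BirchSwinnertonDyer.BirchSwinnertonDyer.Theses.AlignedTransportAtTwo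
  Summit.BirchSwinnertonDyer.BirchSwinnertonDyer.Theorems.AlignedTransportAtTwoSmallCarrierRoad
  Summit.BirchSwinnertonDyer.BirchSwinnertonDyer.Theorems.AlignedTransportAtTwoCubicCarrierRoad

variable (W : WeierstrassCurve ℚ) [W.IsElliptic] [W.IsGloballyMinimal]

omit [W.IsGloballyMinimal] in
/-- **`ℓ₍₂₎(X₀^{rel∞}(W/ℚ_∞)) = 0` from `μ₂ = 0` of `ℚ(β) ⊔ ℚ(x)` for any admissible `x` with `x² = q < 0` rational** — every model,
`β` a root of the `2`-division cubic; admissibility = `x` fixed by every `σ` fixing `W[2]` pointwise with `χ₂(σ) = 1`. §1 at the point `P`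
with `ℚ̄^{Stab P} = ℚ⟮β⟯` (k4-w3 `AddKatoTwo.exists_geomTorsion_two_ne_zero_fixedField_stabilizer_eq_adjoin`), total complexity from
`x² < 0` (`AddKatoTwo.isComplex_of_mem_sq_eq_neg_rat`), then att-p5 g4's dual side. [cite: Lim2017FineSelmer, §3 Thm. 3.5 and Lemma 3.2]
[cite: GreenbergLNM1716, §4 Lemma 4.6 (PDF p. 106)] [cite: CoatesSujatha2005, §3 statement (A)] -/
theorem lengthAt_relaxedDual_eq_zero_of_classicalMu_cubicField_adjoin_of_fixed
    {β : AlgebraicClosure ℚ} (hβ : aeval β W.twoTorsionPolynomial.toPoly = 0)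
    {x : AlgebraicClosure ℚ} {q : ℚ} (hq : q < 0) (hxq : x ^ 2 = algebraMap ℚ (AlgebraicClosure ℚ) q)
    (hx : ∀ g : absoluteGaloisGroup ℚ, (∀ T : W.geomTorsion ((2 : ℕ) : ℤ), g • T = T) →
      GaloisRep.cyclotomicCharacter ℚ 2 g = 1 → g • x = x)
    (hμ : ∀ κF : ZpExtension ↥(IntermediateField.adjoin ℚ ({β} : Set (AlgebraicClosure ℚ)) ⊔
        IntermediateField.adjoin ℚ ({x} : Set (AlgebraicClosure ℚ))) 2, κF.IsCyclotomic → ClassicalMuVanishes κF)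
    {κ : ZpExtension ℚ 2} {γ : Field.absoluteGaloisGroup ℚ} (hκ : κ.IsCyclotomic) (hγ : κ.IsTopGenerator γ)
    (Yr : W.FineSelmerDualDataRelaxedInf κ γ) :
    lengthAt (IwasawaAlgebra 2) Yr.X ⟨IwasawaAlgebra.augIdealP 2, IwasawaAlgebra.isPrime_augIdealP_holds 2⟩ = 0 := by
  obtain ⟨P, hP, hF⟩ := AddKatoTwo.exists_geomTorsion_two_ne_zero_fixedField_stabilizer_eq_adjoin W hβ
  have hxc : ∀ w : InfinitePlace ↥(IntermediateField.fixedField (MulAction.stabilizer (absoluteGaloisGroup ℚ) P) ⊔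
      IntermediateField.adjoin ℚ ({x} : Set (AlgebraicClosure ℚ))), w.IsComplex :=
    AddKatoTwo.isComplex_of_mem_sq_eq_neg_rat x hq hxq _
      ((le_sup_right : IntermediateField.adjoin ℚ ({x} : Set (AlgebraicClosure ℚ)) ≤ _)
        (IntermediateField.mem_adjoin_simple_self ℚ x))
  refine LimRelUpstairs.lengthAt_relaxed_eq_zero_of_finite_pTorsion W κ hγ Yr
    (finite_twoTorsion_fineRelaxed_of_classicalMu_pointField_adjoin_of_fixed W hP hx hxc ?_ κ hκ)
  rw [hF]
  exact hμ

/-- **BOTH SIGNS, per curve: `MC₂(W)` from `μ₂ = 0` of ANY admissible totally complex carrier `ℚ(x(T), x)`** (`x² = q < 0` rational, `x`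
admissible). PRINT⁵ (`h17`, `hGr`, `hper`, `hmod`, `hGZK`) + MuIneqʳ (`hI`) + the cell hypotheses + the one `μ₂`-input ⟹ Mazur's `2`-adic
main conjecture for `W` (p583329's engine through att-p5 g23's (b″) engine). [cite: Kato2004Asterisque, Thm. 17.4 (1)(2) (p. 273)]
[cite: GreenbergLNM1716, Thm. 4.1 (p. 102) and Conj. 1.11 (p. 58)] [cite: Lim2017FineSelmer, §3 Thm. 3.5 and Lemma 3.2] -/
theorem mazurMainConjecture_two_of_muIneqRel_of_classicalMu_cubicField_adjoin_of_fixed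
    (h17 : ∀ [NeZero (W.conductorNorm ℤ)] (f : CuspForm (Gamma0 (W.conductorNorm ℤ)) 2),
      kato_divisibility_allPrimes W 2 (f := f))
    (hGr : Greenberg1999.thm41_charValue_rankZero_anyPrime)
    (hper : realPeriodRat_eq_unit_mul_plusPeriod_two) (hmod : nonempty_modularParametrizationData)
    (hGZK : rank_eq_analyticRank_of_analyticRank_le_one)
    (hI : ∀ (W : WeierstrassCurve ℚ) [W.IsElliptic] [W.IsGloballyMinimal], IsOrdinaryAt W 2 →
      (∀ x : ℚ, ¬ HasRationalTwoTorsionX W x) →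
      ∀ (κ : ZpExtension ℚ 2) (γ : Field.absoluteGaloisGroup ℚ), κ.IsCyclotomic →
      κ.IsTopGenerator γ → IsCyclotomicVariable 2 γ →
      ∀ ⦃N : ℕ⦄ [NeZero N] (f : CuspForm (Gamma0 N) 2), IsNewformOf W f →
      ∀ Gp : IwasawaAlgebra 2, iwasawaToPowerSeries 2 Gp = padicLFunction f (unitRoot W 2 : ℚ_[2]) →
      ∀ (D : W.SelmerDualData κ γ) (Yr : W.FineSelmerDualDataRelaxedInf κ γ),
        lengthAt (IwasawaAlgebra 2) D.X ⟨IwasawaAlgebra.augIdealP 2, IwasawaAlgebra.isPrime_augIdealP_holds 2⟩ ≤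
          lengthAt (IwasawaAlgebra 2) (IwasawaAlgebra 2 ⧸ Ideal.span {Gp})
              ⟨IwasawaAlgebra.augIdealP 2, IwasawaAlgebra.isPrime_augIdealP_holds 2⟩ +
            lengthAt (IwasawaAlgebra 2) Yr.X ⟨IwasawaAlgebra.augIdealP 2, IwasawaAlgebra.isPrime_augIdealP_holds 2⟩)
    (hord : IsOrdinaryAt W 2) (ht : ∀ x : ℚ, ¬ HasRationalTwoTorsionX W x) (hr : W.analyticRank = 0)
    (hμan : ∀ ⦃N : ℕ⦄ [NeZero N] (f : CuspForm (Gamma0 N) 2), IsNewformOf W f →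
      ∀ G : IwasawaAlgebra 2, IsEvenBranchLiftAtTwo W f G → red G ≠ 0)
    (hbsd : BSDp W 2)
    {β : AlgebraicClosure ℚ} (hβ : aeval β W.twoTorsionPolynomial.toPoly = 0)
    {x : AlgebraicClosure ℚ} {q : ℚ} (hq : q < 0) (hxq : x ^ 2 = algebraMap ℚ (AlgebraicClosure ℚ) q)
    (hx : ∀ g : absoluteGaloisGroup ℚ, (∀ T : W.geomTorsion ((2 : ℕ) : ℤ), g • T = T) →
      GaloisRep.cyclotomicCharacter ℚ 2 g = 1 → g • x = x)
    (hμ : ∀ κF : ZpExtension ↥(IntermediateField.adjoin ℚ ({β} : Set (AlgebraicClosure ℚ)) ⊔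
        IntermediateField.adjoin ℚ ({x} : Set (AlgebraicClosure ℚ))) 2, κF.IsCyclotomic → ClassicalMuVanishes κF) :
    MazurMainConjecture W 2 :=
  AlignedTransportAtTwoSeed.mazurMainConjecture_two_of_bsdp_of_mu_eq_zero W h17 hGr hper hmod hGZK hord ht hr hbsd
    fun _ _ hκ hγ hγ' D _ =>
      selmerDual_mu_eq_zero_of_muIneqRel_of_lengthAt_relaxed_eq_zero W hmod hI hord ht hμan hκ hγ hγ'
        (fun Yr => lengthAt_relaxedDual_eq_zero_of_classicalMu_cubicField_adjoin_of_fixed W hβ hq hxq hx hμ hκ hγ Yr) D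

/-- **`0 < Δ_W`, per curve: `MC₂(W)` from «SOME `x` with `x² ∈ {−1, −2, −Δ_W, −2Δ_W}` has `μ₂(ℚ(β, x)^{cyc}) = 0`»** — FOUR totally complex
sextic carriers per curve (`√−1 ∈ μ₄`, `√−2 = ζ₈ + ζ₈³`, `√−Δ = 4iδ`, `√−2Δ` are admissible: k4-w3 §2), plain `μ₂`, no narrow data; PRINT⁵ +
MuIneqʳ + cell hypotheses as before. [cite: Kato2004Asterisque, Thm. 17.4 (1)(2) (p. 273)] [cite: GreenbergLNM1716, Thm. 4.1 (p. 102) and Conj. 1.11 (p. 58)]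
[cite: SilvermanAEC2009, III.§1 and VIII.§1] [cite: Washington1997, §13.1] -/
theorem mazurMainConjecture_two_of_muIneqRel_of_exists_admissibleCarrierMu
    (h17 : ∀ [NeZero (W.conductorNorm ℤ)] (f : CuspForm (Gamma0 (W.conductorNorm ℤ)) 2),
      kato_divisibility_allPrimes W 2 (f := f))
    (hGr : Greenberg1999.thm41_charValue_rankZero_anyPrime)
    (hper : realPeriodRat_eq_unit_mul_plusPeriod_two) (hmod : nonempty_modularParametrizationData)
    (hGZK : rank_eq_analyticRank_of_analyticRank_le_one)
    (hI : ∀ (W : WeierstrassCurve ℚ) [W.IsElliptic] [W.IsGloballyMinimal], IsOrdinaryAt W 2 →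
      (∀ x : ℚ, ¬ HasRationalTwoTorsionX W x) →
      ∀ (κ : ZpExtension ℚ 2) (γ : Field.absoluteGaloisGroup ℚ), κ.IsCyclotomic →
      κ.IsTopGenerator γ → IsCyclotomicVariable 2 γ →
      ∀ ⦃N : ℕ⦄ [NeZero N] (f : CuspForm (Gamma0 N) 2), IsNewformOf W f →
      ∀ Gp : IwasawaAlgebra 2, iwasawaToPowerSeries 2 Gp = padicLFunction f (unitRoot W 2 : ℚ_[2]) →
      ∀ (D : W.SelmerDualData κ γ) (Yr : W.FineSelmerDualDataRelaxedInf κ γ),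
        lengthAt (IwasawaAlgebra 2) D.X ⟨IwasawaAlgebra.augIdealP 2, IwasawaAlgebra.isPrime_augIdealP_holds 2⟩ ≤
          lengthAt (IwasawaAlgebra 2) (IwasawaAlgebra 2 ⧸ Ideal.span {Gp})
              ⟨IwasawaAlgebra.augIdealP 2, IwasawaAlgebra.isPrime_augIdealP_holds 2⟩ +
            lengthAt (IwasawaAlgebra 2) Yr.X ⟨IwasawaAlgebra.augIdealP 2, IwasawaAlgebra.isPrime_augIdealP_holds 2⟩)
    (hord : IsOrdinaryAt W 2) (ht : ∀ x : ℚ, ¬ HasRationalTwoTorsionX W x) (hΔ : 0 < W.Δ) (hr : W.analyticRank = 0)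
    (hμan : ∀ ⦃N : ℕ⦄ [NeZero N] (f : CuspForm (Gamma0 N) 2), IsNewformOf W f →
      ∀ G : IwasawaAlgebra 2, IsEvenBranchLiftAtTwo W f G → red G ≠ 0)
    (hbsd : BSDp W 2)
    {β : AlgebraicClosure ℚ} (hβ : aeval β W.twoTorsionPolynomial.toPoly = 0)
    (hμx : ∃ x : AlgebraicClosure ℚ, (x ^ 2 = -1 ∨ x ^ 2 = -2 ∨ x ^ 2 = -algebraMap ℚ (AlgebraicClosure ℚ) W.Δ ∨
        x ^ 2 = -2 * algebraMap ℚ (AlgebraicClosure ℚ) W.Δ) ∧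
      ∀ κF : ZpExtension ↥(IntermediateField.adjoin ℚ ({β} : Set (AlgebraicClosure ℚ)) ⊔
          IntermediateField.adjoin ℚ ({x} : Set (AlgebraicClosure ℚ))) 2, κF.IsCyclotomic → ClassicalMuVanishes κF) :
    MazurMainConjecture W 2 := by
  obtain ⟨x, hx, hμ⟩ := hμx
  rcases hx with hx | hx | hx | hx
  · have hx4 : x ^ 2 ^ 2 = 1 := by rw [show (2 : ℕ) ^ 2 = 2 * 2 by norm_num, pow_mul, hx]; norm_num
    exact mazurMainConjecture_two_of_muIneqRel_of_classicalMu_cubicField_adjoin_of_fixed W h17 hGr hper hmod hGZK hI hord ht hr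
      hμan hbsd hβ (q := -1) (by norm_num) (by rw [hx]; simp)
      (fun _ _ hχ ↦ AddKatoTwo.smul_eq_self_of_pow_two_pow_eq_one_of_cyclotomicCharacter_eq_one (by norm_num) x hx4 hχ) hμ
  · exact mazurMainConjecture_two_of_muIneqRel_of_classicalMu_cubicField_adjoin_of_fixed W h17 hGr hper hmod hGZK hI hord ht hr
      hμan hbsd hβ (q := -2) (by norm_num) (by rw [hx]; simp)
      (fun _ _ hχ ↦ AddKatoTwo.smul_eq_self_of_sq_eq_neg_two_of_cyclotomicCharacter_eq_one x hx hχ) hμ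
  · exact mazurMainConjecture_two_of_muIneqRel_of_classicalMu_cubicField_adjoin_of_fixed W h17 hGr hper hmod hGZK hI hord ht hr
      hμan hbsd hβ (q := -W.Δ) (by linarith) (by rw [hx, map_neg])
      (fun _ hT hχ ↦ AddKatoTwo.smul_eq_self_of_sq_eq_neg_Δ W x hx hT hχ) hμ
  · exact mazurMainConjecture_two_of_muIneqRel_of_classicalMu_cubicField_adjoin_of_fixed W h17 hGr hper hmod hGZK hI hord ht hr
      hμan hbsd hβ (q := -2 * W.Δ) (by linarith) (by rw [hx, map_mul, map_neg]; simp)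
      (fun _ hT hχ ↦ AddKatoTwo.smul_eq_self_of_sq_eq_neg_two_mul_Δ W x hx hT hχ) hμ

end RatTwo

/-! ## §3 The cell, BY NAME: the crux from PRINT⁵ + MuIneqʳ + H3M⁻ + H6∃⁺ -/

section Cell

open CongruenceSubgroup Literature.NumberTheory.EllipticCurves.ModularForms Literature.NumberTheory.EllipticCurves.Greenberg1999
  Literature.NumberTheory.EllipticCurves.Module
  Summit.BirchSwinnertonDyer.Rank1Residual Summit.BirchSwinnertonDyer.Rank1Residual.X1.MuLambda
  Summit.BirchSwinnertonDyer.Rank1Residual.X5 Summit.BirchSwinnertonDyer.Rank1Residual.F1Sign2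
  Summit.BirchSwinnertonDyer.BirchSwinnertonDyer.Theorems.Rank1ResidualX1Defs
  Summit.BirchSwinnertonDyer.BirchSwinnertonDyer.Theses.AlignedTransportAtTwo
  Summit.BirchSwinnertonDyer.BirchSwinnertonDyer.Theorems.AlignedTransportAtTwoCubicCarrierRoad

/-- **C2 BY NAME with the widened carrier on the totally real third: PRINT {Kato 17.4 (1)(2) at `2`, Greenberg 4.1, period unit, modularity,
GZK} + MuIneqʳ + H3M⁻ + H6∃⁺ ⟹ `MainConjectureOfRankZeroBSDAtTwo`.** H3M⁻ (`hμ3neg`): for every seed-cell `W` with `Δ_W < 0` and every root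
`β` of the `2`-division cubic, `μ₂ = 0` along the cyclotomic `ℤ₂`-extensions of the complex cubic `ℚ(β)` (p739408 §2). H6∃⁺ (`hμ6pos`): for
every seed-cell `W` with `0 < Δ_W` and every root `β`, SOME `x` with `x² ∈ {−1, −2, −Δ_W, −2Δ_W}` such that every cyclotomic `ℤ₂`-extension
of the totally complex sextic `ℚ(β) ⊔ ℚ(x)` has `μ = 0` (§2). CONDITIONAL: the item stmt-BirchSwinnertonDyer-22298 stays open — MuIneqʳ is
print pending typing, H3M⁻/H6∃⁺ are OPEN instances of Iwasawa's `μ`-conjecture for explicit non-abelian fields; BSD is not proved.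
[cite: Kato2004Asterisque, Thm. 17.4 (p. 273) and §17.13 (pp. 279–280)] [cite: GreenbergLNM1716, Thm. 4.1 (p. 102) and Conj. 1.11 (p. 58)]
[cite: Iwasawa1973MuInvariants, Thm. 2 and Thm. 3, §4] [cite: Lim2017FineSelmer, §3 Thm. 3.5 and Lemma 3.2]
[cite: CoatesSujatha2005, §3 statement (A) and Thm. 3.4] -/
theorem mainConjectureOfRankZeroBSDAtTwo_of_muIneqRel_of_cubicFieldMu_of_exists_admissibleCarrierMu
    (h17 : ∀ (V : WeierstrassCurve ℚ) [V.IsElliptic] [V.IsGloballyMinimal] [NeZero (V.conductorNorm ℤ)]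
      (f : CuspForm (Gamma0 (V.conductorNorm ℤ)) 2), kato_divisibility_allPrimes V 2 (f := f))
    (hGr : Greenberg1999.thm41_charValue_rankZero_anyPrime)
    (hper : realPeriodRat_eq_unit_mul_plusPeriod_two) (hmod : nonempty_modularParametrizationData)
    (hGZK : rank_eq_analyticRank_of_analyticRank_le_one)
    (hI : ∀ (W : WeierstrassCurve ℚ) [W.IsElliptic] [W.IsGloballyMinimal], IsOrdinaryAt W 2 →
      (∀ x : ℚ, ¬ HasRationalTwoTorsionX W x) →
      ∀ (κ : ZpExtension ℚ 2) (γ : Field.absoluteGaloisGroup ℚ), κ.IsCyclotomic →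
      κ.IsTopGenerator γ → IsCyclotomicVariable 2 γ →
      ∀ ⦃N : ℕ⦄ [NeZero N] (f : CuspForm (Gamma0 N) 2), IsNewformOf W f →
      ∀ Gp : IwasawaAlgebra 2, iwasawaToPowerSeries 2 Gp = padicLFunction f (unitRoot W 2 : ℚ_[2]) →
      ∀ (D : W.SelmerDualData κ γ) (Yr : W.FineSelmerDualDataRelaxedInf κ γ),
        lengthAt (IwasawaAlgebra 2) D.X ⟨IwasawaAlgebra.augIdealP 2, IwasawaAlgebra.isPrime_augIdealP_holds 2⟩ ≤
          lengthAt (IwasawaAlgebra 2) (IwasawaAlgebra 2 ⧸ Ideal.span {Gp})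
              ⟨IwasawaAlgebra.augIdealP 2, IwasawaAlgebra.isPrime_augIdealP_holds 2⟩ +
            lengthAt (IwasawaAlgebra 2) Yr.X ⟨IwasawaAlgebra.augIdealP 2, IwasawaAlgebra.isPrime_augIdealP_holds 2⟩)
    (hμ3neg : ∀ (W : WeierstrassCurve ℚ) [W.IsElliptic] [W.IsGloballyMinimal], ¬ W.HasCM →
      IsOrdinaryAt W 2 → (∀ x : ℚ, ¬ HasRationalTwoTorsionX W x) → ¬ IsSquare W.Δ →
      W.analyticRank = 0 → BSDp W 2 → W.Δ < 0 →
      ∀ β : AlgebraicClosure ℚ, aeval β W.twoTorsionPolynomial.toPoly = 0 →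
      ∀ κP : ZpExtension ↥(IntermediateField.adjoin ℚ ({β} : Set (AlgebraicClosure ℚ))) 2,
        κP.IsCyclotomic → ClassicalMuVanishes κP)
    (hμ6pos : ∀ (W : WeierstrassCurve ℚ) [W.IsElliptic] [W.IsGloballyMinimal], ¬ W.HasCM →
      IsOrdinaryAt W 2 → (∀ x : ℚ, ¬ HasRationalTwoTorsionX W x) → ¬ IsSquare W.Δ →
      W.analyticRank = 0 → BSDp W 2 → 0 < W.Δ →
      ∀ β : AlgebraicClosure ℚ, aeval β W.twoTorsionPolynomial.toPoly = 0 →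
      ∃ x : AlgebraicClosure ℚ, (x ^ 2 = -1 ∨ x ^ 2 = -2 ∨ x ^ 2 = -algebraMap ℚ (AlgebraicClosure ℚ) W.Δ ∨
          x ^ 2 = -2 * algebraMap ℚ (AlgebraicClosure ℚ) W.Δ) ∧
        ∀ κF : ZpExtension ↥(IntermediateField.adjoin ℚ ({β} : Set (AlgebraicClosure ℚ)) ⊔
            IntermediateField.adjoin ℚ ({x} : Set (AlgebraicClosure ℚ))) 2, κF.IsCyclotomic → ClassicalMuVanishes κF) :
    MainConjectureOfRankZeroBSDAtTwo := by
  intro W _ _ hcm hord ht hsq hr hμan hbsd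
  obtain ⟨β, hβ⟩ := AddKatoTwo.exists_aeval_twoTorsionPolynomial_eq_zero W
  rcases lt_or_gt_of_ne W.isUnit_Δ.ne_zero with hΔ | hΔ
  · exact mazurMainConjecture_two_of_muIneqRel_of_classicalMu_cubicField_of_Δ_neg W (fun f => h17 W f) hGr hper hmod hGZK hI
      hord ht hΔ hr hμan hbsd hβ (hμ3neg W hcm hord ht hsq hr hbsd hΔ β hβ)
  · exact mazurMainConjecture_two_of_muIneqRel_of_exists_admissibleCarrierMu W (fun f => h17 W f) hGr hper hmod hGZK hI hord ht
      hΔ hr hμan hbsd hβ (hμ6pos W hcm hord ht hsq hr hbsd hΔ β hβ)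

end Cell

end Summit.BirchSwinnertonDyer.BirchSwinnertonDyer.Theorems.AlignedTransportAtTwoAdmissibleCarriers

end
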